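import Summits.Ventures.CertifiedManyBodySolver.Theorems.TcThermcert1SaddleTaylor
import Mathlib
import HarnessLib

/-!
# Saddle geometry on the fugacity torus, part 7: the local quadratic bounds at the critical point (clause (ii))

Helper file for route `TcThermcert1`, crux `ThermalStiffnessCeilingU8b10_le_1o8` (item `stmt-Ventures-26381`), line
`Cruxes/ThermalStiffnessCeilingU8b10_le_1o8/Lines/zerofree_corridor.lean` v8, registered stub `stub_saddleGeometry` (K3b); steps S6–S7 of
`Cruxes/ThermalStiffnessCeilingU8b10_le_1o8/STUB-PLAN-stub_saddleGeometry.md`.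

* `saddle_local_bounds` (**clause (ii)**): if `(z₀,w₀) ∈ B̄(7/9,1/18)²` solves the perturbed saddle equations
  `z₀/(1+z₀) + z₀∂_z h = α`, `w₀/(1+w₀) + w₀∂_w h = β` with real targets within `1/300` of `7/16` and lies within `111ε` of the
  real saddle (part 5 `exists_saddle_base_point`, `ε ≤ 1/28000`), then in
  `G(u,v) = [log(1+z₀e^{iu}) − log(1+z₀)] + [log(1+w₀e^{iv}) − log(1+w₀)] + [h(z₀e^{iu},w₀e^{iv}) − h(z₀,w₀)] − i(αu+βv)`
  the linear part vanishes (criticality), and by part 6 for `|u|,|v| ≤ ρ ≤ 1/40`: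
  `Re G ≤ (−1/10 + 16501ρ)(u²+v²)`, `Re G ≥ (−1/7 − 16501ρ)(u²+v²)`, `|Im G| ≤ 412ε(u²+v²) + 16501(|u|+|v|)³` —
  so the K3b prover may take `s = 1/20`, `S = 1/5`, `K = 16501` once `ρ ≤ 3·10⁻⁶` and `ε ≤ τ₀/412`.

[folklore] No definitions; no `sorry`.
-/

noncomputable section

open Complex Metric Set

namespace Summit.Ventures.CertifiedManyBodySolver.Theorems.TcThermcert1.ZeroFreeCorridor

/-! ## §8 Clause (ii): local bounds at the critical point -/

section Local

variable {h : ℂ × ℂ → ℂ} {ε : ℝ}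
  (hh : AnalyticOnNhd ℂ h ({ζ : ℂ | 2 / 3 < ‖ζ‖ ∧ ‖ζ‖ < 8 / 9} ×ˢ {ζ : ℂ | 2 / 3 < ‖ζ‖ ∧ ‖ζ‖ < 8 / 9}))
  (hB : ∀ p ∈ ({ζ : ℂ | 2 / 3 < ‖ζ‖ ∧ ‖ζ‖ < 8 / 9} ×ˢ {ζ : ℂ | 2 / 3 < ‖ζ‖ ∧ ‖ζ‖ < 8 / 9}), ‖h p‖ ≤ ε)
include hh hB

/-- **Clause (ii) of K3b, local bounds at the critical point.** Let `(z₀,w₀) ∈ D = B̄(7/9,1/18)²` solve the perturbed saddle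
equations with real targets `α, β` (`|α − 7/16|, |β − 7/16| ≤ 1/300`) and lie within `111ε` of the real saddle (part 5
`exists_saddle_base_point`, `ε ≤ 1/28000`).  Then the exponent increment along the torus,
`G(u,v) = [log(1+z₀e^{iu}) − log(1+z₀)] + [log(1+w₀e^{iv}) − log(1+w₀)] + [h(z₀e^{iu},w₀e^{iv}) − h(z₀,w₀)] − i(αu+βv)`,
has NO linear term and satisfies, for `|u|, |v| ≤ ρ ≤ 1/40`:
`Re G ≤ (−1/10 + 16501ρ)(u²+v²)`, `Re G ≥ (−1/7 − 16501ρ)(u²+v²)`, `|Im G| ≤ 412ε(u²+v²) + 16501(|u|+|v|)³`. -/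
theorem saddle_local_bounds (hε : ε ≤ 1 / 28000) {z₀ w₀ : ℂ} (hz : ‖z₀ - 7 / 9‖ ≤ 1 / 18)
    (hw : ‖w₀ - 7 / 9‖ ≤ 1 / 18) {α β : ℝ} (hα : |α - 7 / 16| ≤ 1 / 300) (hβ : |β - 7 / 16| ≤ 1 / 300)
    (e1 : z₀ / (1 + z₀) + z₀ * fderiv ℂ h (z₀, w₀) (1, 0) = α)
    (e2 : w₀ / (1 + w₀) + w₀ * fderiv ℂ h (z₀, w₀) (0, 1) = β)
    (hzr : ‖z₀ - ((α / (1 - α) : ℝ) : ℂ)‖ ≤ 111 * ε) (hwr : ‖w₀ - ((β / (1 - β) : ℝ) : ℂ)‖ ≤ 111 * ε)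
    {ρ : ℝ} (hρ : ρ ≤ 1 / 40) {u v : ℝ} (hu : |u| ≤ ρ) (hv : |v| ≤ ρ) (G : ℂ)
    (hG : G = Complex.log (1 + z₀ * cexp ((u : ℂ) * I)) - Complex.log (1 + z₀)
      + (Complex.log (1 + w₀ * cexp ((v : ℂ) * I)) - Complex.log (1 + w₀))
      + (h (z₀ * cexp ((u : ℂ) * I), w₀ * cexp ((v : ℂ) * I)) - h (z₀, w₀)) - I * (α * u + β * v)) :
    G.re ≤ (-(1 / 10) + 16501 * ρ) * (u ^ 2 + v ^ 2) ∧ (-(1 / 7) - 16501 * ρ) * (u ^ 2 + v ^ 2) ≤ G.re ∧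
      |G.im| ≤ 412 * ε * (u ^ 2 + v ^ 2) + 16501 * (|u| + |v|) ^ 3 := by
  have hε0 : 0 ≤ ε := by linarith [norm_nonneg (z₀ - ((α / (1 - α) : ℝ) : ℂ))]
  have hz13 : 13 / 18 ≤ ‖z₀‖ := by have := (norm_bounds_of_near_seven_ninths hz).1; norm_num at this ⊢; linarith
  have hz15 : ‖z₀‖ ≤ 15 / 18 := by have := (norm_bounds_of_near_seven_ninths hz).2; norm_num at this ⊢; linarith
  have hw13 : 13 / 18 ≤ ‖w₀‖ := by have := (norm_bounds_of_near_seven_ninths hw).1; norm_num at this ⊢; linarith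
  have hw15 : ‖w₀‖ ≤ 15 / 18 := by have := (norm_bounds_of_near_seven_ninths hw).2; norm_num at this ⊢; linarith
  have hu0 : 0 ≤ |u| := abs_nonneg u
  have hv0 : 0 ≤ |v| := abs_nonneg v
  have hρ0 : 0 ≤ ρ := hu0.trans hu
  -- the degenerate direction `u = v = 0`
  rcases eq_or_lt_of_le (le_max_of_le_left hu0 : (0 : ℝ) ≤ max |u| |v|) with h0 | hm0'
  · have hu' : u = 0 := abs_eq_zero.mp (le_antisymm (by rw [h0]; exact le_max_left _ _) hu0)
    have hv' : v = 0 := abs_eq_zero.mp (le_antisymm (by rw [h0]; exact le_max_right _ _) hv0)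
    subst hu' hv'
    have hG0 : G = 0 := by rw [hG]; simp
    rw [hG0]
    simp
  obtain ⟨m, hm⟩ : ∃ m : ℝ, m = max |u| |v| := ⟨_, rfl⟩
  have hm0 : 0 < m := by rw [hm]; exact hm0'
  have hum : |u| ≤ m := by rw [hm]; exact le_max_left _ _
  have hvm : |v| ≤ m := by rw [hm]; exact le_max_right _ _
  have hmρ : m ≤ ρ := by rw [hm]; exact max_le hu hv
  -- the three Taylor pieces
  have hEA := taylor_logCircle hz15 (hu.trans (hρ.trans (by norm_num)))
  have hEB := taylor_logCircle hw15 (hv.trans (hρ.trans (by norm_num)))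
  obtain ⟨c₂, hc₂, hEH⟩ := taylor_hSlice hh hB hz13 hz15 hw13 hw15 hum hvm hm0 (hmρ.trans hρ)
  -- the quadratic model `Qv` and the decomposition `G − Qv = E_A + E_B + E_H` (linear terms cancel by `e1`, `e2`)
  have h1z0 : (1 : ℂ) + z₀ ≠ 0 := by
    intro h0
    have : ‖z₀ - 7 / 9‖ = 16 / 9 := by
      rw [show z₀ = -1 from by linear_combination h0, show (-1 : ℂ) - 7 / 9 = ((-(16 / 9) : ℝ) : ℂ) by push_cast; ring,
        Complex.norm_real, Real.norm_eq_abs]; norm_num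
    linarith
  have h1w0 : (1 : ℂ) + w₀ ≠ 0 := by
    intro h0
    have : ‖w₀ - 7 / 9‖ = 16 / 9 := by
      rw [show w₀ = -1 from by linear_combination h0, show (-1 : ℂ) - 7 / 9 = ((-(16 / 9) : ℝ) : ℂ) by push_cast; ring,
        Complex.norm_real, Real.norm_eq_abs]; norm_num
    linarith
  obtain ⟨F₁, hF₁⟩ : ∃ F : ℂ, F = z₀ / (2 * (1 + z₀) ^ 2) := ⟨_, rfl⟩
  obtain ⟨F₂, hF₂⟩ : ∃ F : ℂ, F = w₀ / (2 * (1 + w₀) ^ 2) := ⟨_, rfl⟩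
  have hT₁F : -z₀ / (1 + z₀) ^ 2 / 2 = -F₁ := by rw [hF₁]; field_simp
  have hT₂F : -w₀ / (1 + w₀) ^ 2 / 2 = -F₂ := by rw [hF₂]; field_simp
  rw [hT₁F] at hEA
  rw [hT₂F] at hEB
  obtain ⟨Qv, hQv⟩ : ∃ Q : ℂ, Q = -F₁ * ((u ^ 2 : ℝ) : ℂ) + -F₂ * ((v ^ 2 : ℝ) : ℂ) + c₂ / 2 := ⟨_, rfl⟩
  have hdec : G - Qv =
      (Complex.log (1 + z₀ * cexp ((u : ℂ) * I)) - Complex.log (1 + z₀) - I * z₀ / (1 + z₀) * u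
          - -F₁ * (u : ℂ) ^ 2) +
        (Complex.log (1 + w₀ * cexp ((v : ℂ) * I)) - Complex.log (1 + w₀) - I * w₀ / (1 + w₀) * v
          - -F₂ * (v : ℂ) ^ 2) +
        (h (z₀ * cexp ((u : ℂ) * I), w₀ * cexp ((v : ℂ) * I)) - h (z₀, w₀)
          - (I * u * (z₀ * fderiv ℂ h (z₀, w₀) (1, 0)) + I * v * (w₀ * fderiv ℂ h (z₀, w₀) (0, 1))) - c₂ / 2) := by
    rw [hG, hQv, ← e1, ← e2, Complex.ofReal_pow, Complex.ofReal_pow]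
    ring
  have hGQ : ‖G - Qv‖ ≤ 16500 * |u| ^ 3 + 16500 * |v| ^ 3 + 16000 * ε * m ^ 3 := by
    rw [hdec]
    exact ((norm_add_le _ _).trans (add_le_add (norm_add_le _ _) le_rfl)).trans
      (add_le_add (add_le_add hEA hEB) hEH)
  -- sizes of `m`
  have huu : 0 ≤ u ^ 2 := sq_nonneg u
  have hvv : 0 ≤ v ^ 2 := sq_nonneg v
  have hu2 : |u| ^ 2 = u ^ 2 := sq_abs u
  have hv2 : |v| ^ 2 = v ^ 2 := sq_abs v
  have hm2 : m ^ 2 ≤ u ^ 2 + v ^ 2 := by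
    rcases max_choice |u| |v| with h | h
    · rw [hm, h, sq_abs]; linarith only [hvv]
    · rw [hm, h, sq_abs]; linarith only [huu]
  have hm3s : m ^ 3 ≤ (|u| + |v|) ^ 3 :=
    pow_le_pow_left₀ hm0.le (by rw [hm]; exact max_le (by linarith only [hv0]) (by linarith only [hu0])) 3
  have hm3r : m ^ 3 ≤ ρ * (u ^ 2 + v ^ 2) := by
    calc m ^ 3 = m * m ^ 2 := by ring
      _ ≤ ρ * (u ^ 2 + v ^ 2) := by gcongr
  have hu3 : |u| ^ 3 ≤ ρ * u ^ 2 := by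
    rw [← hu2]
    calc |u| ^ 3 = |u| * |u| ^ 2 := by ring
      _ ≤ ρ * |u| ^ 2 := by gcongr
  have hv3 : |v| ^ 3 ≤ ρ * v ^ 2 := by
    rw [← hv2]
    calc |v| ^ 3 = |v| * |v| ^ 2 := by ring
      _ ≤ ρ * |v| ^ 2 := by gcongr
  have huv3 : |u| ^ 3 + |v| ^ 3 ≤ (|u| + |v|) ^ 3 := by
    have := mul_nonneg (mul_nonneg hu0 hv0) (add_nonneg hu0 hv0)
    linarith only [this]
  have hEHs : 16000 * ε * m ^ 3 ≤ m ^ 3 := by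
    have h1 : 16000 * ε ≤ 1 := by linarith only [hε]
    have := mul_le_mul_of_nonneg_right h1 (pow_nonneg hm0.le 3)
    linarith only [this]
  have hGQρ : ‖G - Qv‖ ≤ 16501 * ρ * (u ^ 2 + v ^ 2) := by linarith only [hGQ, hu3, hv3, hEHs, hm3r]
  have hGQs : ‖G - Qv‖ ≤ 16501 * (|u| + |v|) ^ 3 := by linarith only [hGQ, huv3, hEHs, hm3s]
  -- the curvature coefficients against the real model
  have hquad : ∀ γ : ℝ, |γ - 7 / 16| ≤ 1 / 300 → 307 / 2500 ≤ γ * (1 - γ) / 2 ∧ γ * (1 - γ) / 2 ≤ 1233 / 10000 := by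
    intro γ hγ
    obtain ⟨h1, h2⟩ := abs_le.mp hγ
    have hd2 : (γ - 7 / 16) ^ 2 ≤ (1 / 300) ^ 2 := by
      rw [← sq_abs]; exact pow_le_pow_left₀ (abs_nonneg _) hγ 2
    constructor
    · linarith only [hd2, h1]
    · linarith only [sq_nonneg (γ - 441 / 1000), h2]
  have hαq := hquad α hα
  have hβq := hquad β hβ
  have hF₁d : ‖F₁ - ((α * (1 - α) / 2 : ℝ) : ℂ)‖ ≤ 111 / 10 * ε := by
    rw [hF₁]; exact (norm_halfCurv_sub_le hz hα).trans (by linarith only [hzr])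
  have hF₂d : ‖F₂ - ((β * (1 - β) / 2 : ℝ) : ℂ)‖ ≤ 111 / 10 * ε := by
    rw [hF₂]; exact (norm_halfCurv_sub_le hw hβ).trans (by linarith only [hwr])
  have hF₁re : |F₁.re - α * (1 - α) / 2| ≤ 111 / 10 * ε := by
    have := (Complex.abs_re_le_norm (F₁ - ((α * (1 - α) / 2 : ℝ) : ℂ))).trans hF₁d
    rwa [Complex.sub_re, Complex.ofReal_re] at this
  have hF₁im : |F₁.im| ≤ 111 / 10 * ε := by
    have := (Complex.abs_im_le_norm (F₁ - ((α * (1 - α) / 2 : ℝ) : ℂ))).trans hF₁d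
    rwa [Complex.sub_im, Complex.ofReal_im, sub_zero] at this
  have hF₂re : |F₂.re - β * (1 - β) / 2| ≤ 111 / 10 * ε := by
    have := (Complex.abs_re_le_norm (F₂ - ((β * (1 - β) / 2 : ℝ) : ℂ))).trans hF₂d
    rwa [Complex.sub_re, Complex.ofReal_re] at this
  have hF₂im : |F₂.im| ≤ 111 / 10 * ε := by
    have := (Complex.abs_im_le_norm (F₂ - ((β * (1 - β) / 2 : ℝ) : ℂ))).trans hF₂d
    rwa [Complex.sub_im, Complex.ofReal_im, sub_zero] at this
  have hεm : ε * m ^ 2 ≤ ε * (u ^ 2 + v ^ 2) := mul_le_mul_of_nonneg_left hm2 hε0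
  have hc₂' : ‖c₂ / 2‖ ≤ 400 * ε * (u ^ 2 + v ^ 2) := by
    rw [norm_div, show ‖(2 : ℂ)‖ = 2 by simp]
    linarith only [hc₂, hεm]
  have hc₂re : |(c₂ / 2).re| ≤ 400 * ε * (u ^ 2 + v ^ 2) := (Complex.abs_re_le_norm _).trans hc₂'
  have hc₂im : |(c₂ / 2).im| ≤ 400 * ε * (u ^ 2 + v ^ 2) := (Complex.abs_im_le_norm _).trans hc₂'
  -- real and imaginary parts of the model
  have hQre : Qv.re = -(F₁.re * u ^ 2) - F₂.re * v ^ 2 + (c₂ / 2).re := by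
    rw [hQv, Complex.add_re, Complex.add_re, Complex.re_mul_ofReal, Complex.re_mul_ofReal, Complex.neg_re,
      Complex.neg_re]
    ring
  have hQim : Qv.im = -(F₁.im * u ^ 2) - F₂.im * v ^ 2 + (c₂ / 2).im := by
    rw [hQv, Complex.add_im, Complex.add_im, Complex.im_mul_ofReal, Complex.im_mul_ofReal, Complex.neg_im,
      Complex.neg_im]
    ring
  have hGre : G.re = Qv.re + (G - Qv).re := by rw [Complex.sub_re]; ring
  have hGim : G.im = Qv.im + (G - Qv).im := by rw [Complex.sub_im]; ring
  have hdre : |(G - Qv).re| ≤ ‖G - Qv‖ := Complex.abs_re_le_norm _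
  have hdim : |(G - Qv).im| ≤ ‖G - Qv‖ := Complex.abs_im_le_norm _
  -- products with the nonnegative squares, then linear bookkeeping
  obtain ⟨hF₁re1, hF₁re2⟩ := abs_le.mp hF₁re
  obtain ⟨hF₂re1, hF₂re2⟩ := abs_le.mp hF₂re
  obtain ⟨hc₂re1, hc₂re2⟩ := abs_le.mp hc₂re
  obtain ⟨hc₂im1, hc₂im2⟩ := abs_le.mp hc₂im
  obtain ⟨hdre1, hdre2⟩ := abs_le.mp hdre
  obtain ⟨hdim1, hdim2⟩ := abs_le.mp hdim
  have p1 : (307 / 2500 - 111 / 10 * ε) * u ^ 2 ≤ F₁.re * u ^ 2 :=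
    mul_le_mul_of_nonneg_right (by linarith only [hF₁re1, hαq.1]) huu
  have p2 : F₁.re * u ^ 2 ≤ (1233 / 10000 + 111 / 10 * ε) * u ^ 2 :=
    mul_le_mul_of_nonneg_right (by linarith only [hF₁re2, hαq.2]) huu
  have p3 : (307 / 2500 - 111 / 10 * ε) * v ^ 2 ≤ F₂.re * v ^ 2 :=
    mul_le_mul_of_nonneg_right (by linarith only [hF₂re1, hβq.1]) hvv
  have p4 : F₂.re * v ^ 2 ≤ (1233 / 10000 + 111 / 10 * ε) * v ^ 2 :=
    mul_le_mul_of_nonneg_right (by linarith only [hF₂re2, hβq.2]) hvv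
  have p5 : |F₁.im * u ^ 2| ≤ 111 / 10 * ε * u ^ 2 := by
    rw [abs_mul, abs_of_nonneg huu]; exact mul_le_mul_of_nonneg_right hF₁im huu
  have p6 : |F₂.im * v ^ 2| ≤ 111 / 10 * ε * v ^ 2 := by
    rw [abs_mul, abs_of_nonneg hvv]; exact mul_le_mul_of_nonneg_right hF₂im hvv
  obtain ⟨p51, p52⟩ := abs_le.mp p5
  obtain ⟨p61, p62⟩ := abs_le.mp p6
  have hεs : 4111 / 10 * ε ≤ 3 / 200 := by linarith only [hε]
  have q1 : 4111 / 10 * ε * u ^ 2 ≤ 3 / 200 * u ^ 2 := mul_le_mul_of_nonneg_right hεs huu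
  have q2 : 4111 / 10 * ε * v ^ 2 ≤ 3 / 200 * v ^ 2 := mul_le_mul_of_nonneg_right hεs hvv
  have hεuv : 0 ≤ ε * (u ^ 2 + v ^ 2) := mul_nonneg hε0 (add_nonneg huu hvv)
  have hρuv : 0 ≤ ρ * (u ^ 2 + v ^ 2) := mul_nonneg hρ0 (add_nonneg huu hvv)
  refine ⟨?_, ?_, ?_⟩
  · rw [hGre, hQre]
    linarith only [p1, p3, hc₂re2, hdre2, hGQρ, q1, q2, huu, hvv]
  · rw [hGre, hQre]
    linarith only [p2, p4, hc₂re1, hdre1, hGQρ, q1, q2, huu, hvv]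
  · rw [hGim, hQim, abs_le]
    constructor
    · linarith only [p52, p62, hc₂im1, hdim1, hGQs, hεuv]
    · linarith only [p51, p61, hc₂im2, hdim2, hGQs, hεuv]

end Local

end Summit.Ventures.CertifiedManyBodySolver.Theorems.TcThermcert1.ZeroFreeCorridor

end
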